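import Summits.BirchSwinnertonDyer.BirchSwinnertonDyer.Theorems.GoldfeldAllTwistsTwoConverseTwinQuarterTraceIndexB4SevenModEightOrBetaModFourUnion
import Summits.BirchSwinnertonDyer.BirchSwinnertonDyer.Theorems.GoldfeldAllTwistsTwoConverseTwinQuarterTraceIndexB4BetaPlusSharp
import HarnessLib

set_option linter.dupNamespace false -- namespace `…BirchSwinnertonDyer.BirchSwinnertonDyer…` is the cell's (D-0017 nested layout)
set_option autoImplicit false

/-!
# OBJECT 7 «Uβ5» (RULINGS (cdix) (5) / (cdxxiv) / (cdxxv)), file Uβ5-F: the `(p/q)`-FREE FORMULA-AXIS CAPSTONE on the type-β `p ≡ 5 (mod 8)` two-prime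
# family — `BSD(W, 2)` on C6 ∪ C8 ∪ b35+ ∪ b75+ from SIXTEEN named inputs (the FIFTEEN + Kolyvagin), NO `hpq` binder, NO Cassels–Tate

Cell `bsd-goldfeld`, seat `bsd-goldfeld-s1p-c3x` (gen 18); planner RULINGS (cdix) (5), (cdxxiv), (cdxxv) (exact typing). `--supports stmt-BirchSwinnertonDyer-19140
--as helper` (formula axis). Theses-free; ONE theorem by cases, nothing else; 0 def, 0 new fact, no `sorry`, no kit. Companion of Uβ5-R
(`…TwinQuarterTraceBetaPFiveSymbolFreeUnion`).

THE UNION. {`q` prime, `q > 3`, `q ≡ 3 (mod 4)`, `(q/7) = −1`} × {`p` prime, `p ≡ 5 (mod 8)`, `(−7/p) = +1`, type β}, `W/ℚ` globally minimal with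
`C • W = X₀(49)^{(−2qp)}`, WHATEVER `(p/q)`: at `(p/q) = +1` the B5⁺ closer Fβ⁺-6 `bsdp_two_negTwoPrimesTwist_betaPlusPFive_of_print_sharp` (p707803) and at
`(p/q) = −1` U′-F §1 `bsdp_two_negTwoPrimesTwist_beta_modFour_of_print_sharp` (p687053, `p ≡ 1 (mod 4)`-generic, ∃-form `hC`) give **`BSD(W, 2)`** — by name,
one case split. BINDERS = EXACTLY the SIXTEEN = FIFTEEN + `hKo` {`hCST hGZ h12 h44 h13 h14 hS31 hnew hM hBT hBF hGZK hEta hEta₀ hD hKo`} carried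
LETTER-IDENTICALLY by both consumed theorems (`…IndexB4BetaPlusSharp` l.282, `…IndexB4SevenModEightOrBetaModFourUnion` l.49); NO `hCT` / `hBCST` / `hpar` / `h2`.
HONEST FRAMING: density-ZERO sub-families modulo named print (SELMER-DRIFT ceiling (ccclxxxi)); FRONTIER-grade, never distance-to-summit; twin″ (item 19140) is
NOT closed; items 19350 / 20044 unchanged; BSD is not proved by any of this.

References: [Miller2011LMS] Def. 1.1; [GrossZagier1986] Thm I.(6.3), V.§2; [Gross1984] §§4–5; [CoatesLiTianZhai2015] Thm 1.2–1.4, 4.4; [LiMa2008] Thm 0.4;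
[SilvermanAEC2009] X.4.14.
-/

noncomputable section

open scoped Classical

open WeierstrassCurve NumberField Literature.NumberTheory Literature.NumberTheory.EllipticCurves
  Literature.NumberTheory.EllipticCurves.ModularForms Literature.NumberTheory.EllipticCurves.CaiShuTian2014
  Literature.NumberTheory.EllipticCurves.CoatesLiTianZhai2015

namespace Summit.BirchSwinnertonDyer.BirchSwinnertonDyer.Theorems.GoldfeldGoodTwists

section UnionBetaPFiveFormula

variable (hCST : thm11_ringClassChar)
  (hGZ : ∀ (N : ℕ) [NeZero N] (W : WeierstrassCurve ℚ) (K : Type) [Field K] [NumberField K], gross_zagier N W K)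
  (h12 : thm12_fullBSD_twist) (h44 : thm44_ord_two_LAlg) (h13 : thm13_ord_two_LAlg) (h14 : thm14_rankOne_twist)
  (hS31 : bsdTriple_of_rank_le_one_of_conductor_lt) (hnew : exists_isNewformOf) (hM : OptimalCurveManinCertificate cm7)
  (hBT : burungaleTian_analyticRank_eq_zero_of_selmerCorank_eq_zero_of_hasCM) (hBF : bsdTriple_of_hasCM_of_L_one_ne_zero)
  (hGZK : rank_eq_analyticRank_of_analyticRank_le_one) (hEta : x049_heegner_norm_x_sub_two_not_mem)
  (hEta₀ : x049_x_sub_two_eq_etaQuotient) (hD : deuring_etaQuotient49_heegner_generates_conjPrime)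
  (hKo : ∀ (N : ℕ) [NeZero N] (W : WeierstrassCurve ℚ) (K : Type) [Field K] [NumberField K], kolyvagin N W K)
include hCST hGZ h12 h44 h13 h14 hS31 hnew hM hBT hBF hGZK hEta hEta₀ hD hKo

/-- **`BSD(W, 2)` on the type-β `p ≡ 5 (mod 8)` two-prime family, WHATEVER `(p/q)`, FROM PRINT + KOLYVAGIN.** `q > 3` prime, `q ≡ 3 (mod 4)`,
`(q/7) = −1`; `p ≡ 5 (mod 8)` prime, `(−7/p) = +1`, `−7` a fourth power mod `p`; NO `(p/q)` binder; `W/ℚ` globally minimal elliptic with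
`C • W = X₀(49)^{(−2qp)}`: **`BSD(W, 2)`** (Miller: rank part, `Ш(W)[2^∞]` finite, `ord₂ #Ш_an = ord₂ #Ш[2^∞]`) — by cases on `jacobiSym p q = ±1` onto Fβ⁺-6
`bsdp_two_negTwoPrimesTwist_betaPlusPFive_of_print_sharp` (`(p/q) = +1`) ∣ U′-F §1 `bsdp_two_negTwoPrimesTwist_beta_modFour_of_print_sharp` (`(p/q) = −1`).
SIXTEEN named inputs (both parents', by name), nothing else; NO Cassels–Tate. Density-zero sub-families modulo named print; FRONTIER-grade; twin″ NOT closed;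
BSD is not proved by any of this. [cite: Miller2011LMS, Def. 1.1] [cite: GrossZagier1986, Thm. I.(6.3) and V.§2] [cite: CoatesLiTianZhai2015, Thm. 1.2 (p. 359), 1.3, 1.4 and 4.4]
[cite: LiMa2008, Thm. 0.4] [cite: SilvermanAEC2009, Thm. X.4.14] -/
theorem bsdp_two_negTwoPrimesTwist_betaPFive_symbolFree_of_print_sharp
    {q p : ℕ} (hq : q.Prime) (h3 : 3 < q) (hq4 : q % 4 = 3) (hq7 : jacobiSym q 7 = -1)
    [Fact p.Prime] (hp8 : p % 8 = 5) (hp7 : legendreSym p (-7) = 1) (hβ : ∃ x : ZMod p, x ^ 4 = -7)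
    (W : WeierstrassCurve ℚ) [W.IsElliptic] [W.IsGloballyMinimal] (C : VariableChange ℚ)
    (hC : C • W = cm7.quadraticTwist (-(2 * (q : ℚ) * p))) : BSDp W 2 := by
  have hp : p.Prime := Fact.out
  have hp4 : p % 4 = 1 := by omega
  have hne : p ≠ q := by rintro rfl; omega
  have hgcd : Int.gcd (p : ℤ) q = 1 := by rw [Int.gcd_natCast_natCast]; exact (Nat.coprime_primes hp hq).mpr hne
  rcases jacobiSym.eq_one_or_neg_one hgcd with hpq | hpq
  · exact bsdp_two_negTwoPrimesTwist_betaPlusPFive_of_print_sharp hCST hGZ h12 h44 h13 h14 hS31 hnew hM hBT hBF hGZK hEta hEta₀ hD hKo hq h3 hq4 hq7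
      hp8 hp7 hβ hpq W C hC
  · exact bsdp_two_negTwoPrimesTwist_beta_modFour_of_print_sharp hCST hGZ h12 h44 h13 h14 hS31 hnew hM hBT hBF hGZK hEta hEta₀ hD hKo hq h3 hq4 hq7
      hp4 hp7 hβ hpq W ⟨C, hC⟩

end UnionBetaPFiveFormula

end Summit.BirchSwinnertonDyer.BirchSwinnertonDyer.Theorems.GoldfeldGoodTwists

end
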